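/-
Copyright (c) 2026 the pub-hodgecm-mathlib formalisation cell (harness21).  Prover seat hodgecm-mathlib-K2E1-p08 (g4), Track B ∕ K2-LIT, h413 =
`stmt-HodgeConjecture-24833`, line `K2_E1_TraceFormulaBeta`, campaign «RES-RANK-ONE»; DEAL of the dealer K2E1-plan (g2) 2026-09-04T02:44:20Z (the GROUP SIDE of
(H4-prep)): the MODULUS-ONE DISCHARGE — conjugation by a rational point of the Borel of `U(Φ_N)` (`N = 2, 3`) PRESERVES the Haar measure of the unipotent
radical `N(𝔸_{L⁺})`, so the constant-term functional is left-`P(L⁺)`-invariant (★ `K2E1ConstantTermTorusU`, consumer form, all three binders supplied here).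
-/
import Summits.HodgeConjecture.HodgeConjecture.Theorems.K2E1ConstantTermTorusU            -- ★ (K2E1-p02 g4): `setIntegral_constantTerm_mul_eq_of_normalizes` (the consumer form)
import Summits.HodgeConjecture.HodgeConjecture.Theorems.K2E1SiegelRadicalCocompactU2      -- ★ `N = 2`: `upperUnitriangular_eq_standardUnipotentRadical_two`, `countable_rational_cmParabolicData`, `finiteCovolume_cmParabolicData_two`
import Summits.HodgeConjecture.HodgeConjecture.Theorems.K2E1HeisenbergRadicalCocompactU3  -- ★ `N = 3`: `upperUnitriangular_eq_flagUnipotentRadical_three`, `countable_rational_cmParabolicDataR_three`, `finiteCovolume_cmParabolicDataR_three`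
import Literature.MeasureTheory.Group.HaarCharLattice                                     -- ★ THE LATTICE LEMMA `map_continuousMulEquiv_eq_self` (an automorphism preserving a lattice preserves Haar measure)
import Literature.NumberTheory.Automorphic.IwahoriGL                                      -- ★ `standardParabolicGL_le_normalizer_unipotentRadicalGL` (`P` normalises `U`)
import HarnessLib

/-!
# K2·E1 — `K2E1BorelLeviU`: CONJUGATION BY A RATIONAL BOREL ELEMENT OF `U(Φ_N)` PRESERVES THE HAAR MEASURE OF THE RADICAL (`N = 2, 3`)
# (campaign «RES-RANK-ONE», group side of (H4-prep): the modulus-one discharge `|δ_P(γ)|_𝔸 = 1` on `P(L⁺)`, matrix-free)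

Track B ∕ K2-LIT, crux h413 = `stmt-HodgeConjecture-24833`, route of record `HCCMUnconditional`; cell `hodgecm-mathlib`, squad K2, ENGINE E1 (socket module
`K2_E1_TraceFormulaBetaSigs_GlobalIndex` ED. 12; live sockets 5Res ∕ 12R3 read «⟸ (FD) `L²_res(U(Φ_N))` is `K`-admissible», ★ p856793).  Prover seat
`hodgecm-mathlib-K2E1-p08` (g4); DEAL of the dealer K2E1-plan (g2) 2026-09-04T02:44:20Z + contract 02:44:52Z.  THEOREMS ONLY (no `def`, no `instance`, no notation,
no named-fact hypothesis, no `sorry`); lane `--supports stmt-HodgeConjecture-24833 --as helper` (count-neutral).  Closes no socket.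

THE POINT.  ★ `K2E1ConstantTermTorusU.setIntegral_constantTerm_mul_eq_of_normalizes` (K2E1-p02 (g4)) proves `CT_𝓕 ψ (x·γ) = CT_𝓕 ψ (x)` for a rational `γ`
normalising the radical `N_i(𝔸)` PROVIDED the conjugation `u ↦ γuγ⁻¹` preserves the Haar measure `ν_N` of `N_i(𝔸)` («modulus one», its hypothesis `hmod`).  This file
DISCHARGES `hmod` (and the normalisation binders `hN`, `hN'`) for the quasi-split unitary groups of the line, for EVERY rational point of the BOREL — Levi AND
radical points at once — WITHOUT matrices and WITHOUT the product formula: by the LATTICE LEMMA (★ `Literature.MeasureTheory.Group.HaarCharLattice`, Raghunathan I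
Rem. 1.9 ∕ Weil II §4) «a topological automorphism of a locally compact group `N` mapping a lattice `Γ` (countable, with a fundamental domain of finite positive
covolume) onto itself preserves Haar measure», applied to `N = N_i(𝔸)`, `Γ = N_i(K)` (a lattice by ★ Tate: `K ⊂ 𝔸_K` discrete cocompact, ★ p855468 ∕ ★
`K2E1SiegelRadicalCocompactU2` ∕ ★ `K2E1HeisenbergRadicalCocompactU3`) and `φ = (u ↦ γuγ⁻¹)`, `γ ∈ G(K)` (so `φ(N_i(K)) = N_i(K)`).  The product formula
`|δ_P(m)|_𝔸 = ∏_v |a ā|_v = 1` of the printed argument [MoeglinWaldspurger1995, I.2.6; BorelJacquet1979, §4.4] is exactly the abelian case `N = 𝔸_K`, `Γ = K` of the same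
lemma; the explicit ADELIC modulus `δ_B(diag(d)) = torusRootModulus` stays ★ `UnitaryGroupBorelModulusTwo`∕`Three` (cited, not restated).

WHAT.
* §1 GENERIC (any ★ `AdelicGroupData` 𝒢, any ★ `ParabolicUnipotentData` 𝔓, index `i`): `measure_fundamentalDomain_ne_zero` (a fundamental domain of the countable
  `N_i(K)` has non-zero measure for a left-invariant measure positive on opens); **`measurePreserving_conj_of_isFundamentalDomain`** — for `γ ∈ G(K)` with
  `γN_i(𝔸)γ^{±1} ⊆ N_i(𝔸)`, every REGULAR HAAR measure `ν_N` on `N_i(𝔸)` and ONE fundamental domain `𝓕` of `N_i(K)` with `ν_N 𝓕 < ∞`: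
  `MeasurePreserving (u ↦ γuγ⁻¹) ν_N ν_N`; corollary **`setIntegral_constantTerm_mul_eq_of_isFundamentalDomain`** = ★ p02's conclusion with `hmod` discharged.
* §2 `U(Φ₂)` at `𝔓 := cmParabolicData L 2` (the Siegel = Borel radical, ★ p855325): the radical is CLOSED (`isClosed_cmParabolicData_radical_two`), normalised by every
  UPPER-TRIANGULAR adelic point (`conj_mem_cmParabolicData_radical_two`, via ★ `P_id` normalises `U_id` in `GL₂(𝔸_L)` and ★ `upperUnitriangular_eq_standardUnipotentRadical_two`);
  **`measurePreserving_conj_cmParabolicData_two`** (every Haar `ν_N`, every rational upper-triangular `γ`, given any fundamental domain — ★ `countable_rational_cmParabolicData`,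
  ★ `finiteCovolume_cmParabolicData_two` supply the lattice data) and **`setIntegral_constantTerm_mul_eq_cmParabolicData_two`**: `CT_𝓕 ψ (x·γ) = CT_𝓕 ψ (x)` for ALL
  `γ ∈ B(L⁺)`.
* §3 `U(Φ₃)` at `𝔓 := cmParabolicDataR L 3` (the HEISENBERG radical of record, ★ p855423): the same four statements (`…_cmParabolicDataR_three`), via ★
  `upperUnitriangular_eq_flagUnipotentRadical_three`, ★ `countable_rational_cmParabolicDataR_three`, ★ `finiteCovolume_cmParabolicDataR_three`.  (The `𝓕`-free forms —
  EXISTENCE of a fundamental domain of finite measure in the route's currency, from Tate's `𝓕_N` — are the companion file `K2E1BorelLeviUDomains`.)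
* §4 RATIONAL BOREL POINTS AS INPUTS: for `g ∈ U(Φ_N)(L⁺)` upper triangular (in particular a rational LEVI element `diag(a, ā⁻¹)` ∕ `diag(a, b, ā⁻¹)`), `γ := toAdelic g` is
  rational (`toAdelic_mem_arithmeticSubgroup`) and upper triangular in `GL_N(𝔸_L)` (`adelicVal_toAdelic_mem_standardParabolicGL`) — the two binders of §2–§3.
HONEST LABEL: HC_CM is proved only modulo the 7 printed citations (2 remaining named inputs: hLiu418 = `stmt-HodgeConjecture-24832`, h413 =
`stmt-HodgeConjecture-24833`) until rung 0 closes; this file asserts no named fact and closes no socket.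
References: [MoeglinWaldspurger1995] C. Mœglin, J.-L. Waldspurger, *Spectral Decomposition and Eisenstein Series* (1995), I.2.6 · [BorelJacquet1979] A. Borel, H. Jacquet,
Corvallis PSPM 33.1 (1979), §4.4 · [Raghunathan1972] M. S. Raghunathan, *Discrete Subgroups of Lie Groups* (1972), Ch. I Remark 1.9 · [Rogawski1990] J. D. Rogawski,
*Automorphic Representations of Unitary Groups in Three Variables* (1990), §1.10 p. 9, §2.2 p. 13 · [CasselsFrohlichANT1967] Ch. XV Thm. 4.1.3 (Tate).
-/

set_option autoImplicit false
-- the mandated namespace repeats the single-problem summit's segment (`HodgeConjecture.HodgeConjecture`)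
set_option linter.dupNamespace false

noncomputable section

open MeasureTheory Measure Set Topology NumberField IsDedekindDomain
open scoped ENNReal Pointwise MatrixGroups
open Literature.NumberTheory.Automorphic Literature.NumberTheory.Automorphic.UnitaryGroup AdelicGroupData
open Literature.MeasureTheory.Group (map_continuousMulEquiv_eq_self)
open Summit.HodgeConjecture.HodgeConjecture.Cruxes.H413.K2E1CuspidalSpectrumUnitary
  (cmUnipotentRadical cmParabolicData mem_cmUnipotentRadical_iff cmUnipotentRadicalR cmParabolicDataR mem_cmUnipotentRadicalR_iff flagUnipotentRadical)
open Summit.HodgeConjecture.HodgeConjecture.Cruxes.H413.K2E1SiegelRadicalCocompactU2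
  (upperUnitriangular_eq_standardUnipotentRadical_two countable_rational_cmParabolicData finiteCovolume_cmParabolicData_two)
open Summit.HodgeConjecture.HodgeConjecture.Cruxes.H413.K2E1HeisenbergRadicalCocompactU3
  (upperUnitriangular_eq_flagUnipotentRadical_three countable_rational_cmParabolicDataR_three finiteCovolume_cmParabolicDataR_three)
open Summit.HodgeConjecture.HodgeConjecture.Cruxes.H413.K2E1ConstantTermTorusU (setIntegral_constantTerm_mul_eq_of_normalizes)
open Literature.AlgebraicGeometry.ShimuraVarieties (unitaryGroup)

namespace Summit.HodgeConjecture.HodgeConjecture.Cruxes.H413.K2E1BorelLeviU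

universe u

/-! ## §1 Generic: conjugation by a rational normaliser of the radical preserves the Haar measure of `N_i(𝔸)` (the lattice lemma) -/

section Generic

variable {K : Type} [Field K] [NumberField K] {𝒢 : AdelicGroupData.{u} K} (𝔓 : 𝒢.ParabolicUnipotentData) {i : 𝔓.ι}
  [MeasurableSpace (𝔓.radical i)] [BorelSpace (𝔓.radical i)]

/-- **A fundamental domain of `N_i(K)` in `N_i(𝔸)` has non-zero measure** for every left-invariant measure positive on open sets (e.g. a Haar measure): the countably
many translates `δ𝓕`, `δ ∈ N_i(K)`, cover `N_i(𝔸)` a.e. and all have measure `ν_N 𝓕` (Mathlib `IsFundamentalDomain.measure_zero_of_invariant` at `t = univ`).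
[cite: BorelJacquet1979, §4.4] -/
theorem measure_fundamentalDomain_ne_zero (νN : Measure (𝔓.radical i)) [νN.IsMulLeftInvariant] [νN.IsOpenPosMeasure] [Countable (𝔓.rational i)]
    {𝓕 : Set (𝔓.radical i)} (h𝓕 : IsFundamentalDomain (𝔓.rational i) 𝓕 νN) : νN 𝓕 ≠ 0 := by
  intro h0
  have huniv : νN univ = 0 :=
    h𝓕.measure_zero_of_invariant univ (fun _ => smul_set_univ) (by rw [univ_inter]; exact h0)
  exact IsOpenPosMeasure.open_pos univ isOpen_univ univ_nonempty huniv

/-- **THE MODULUS-ONE ENGINE (lattice lemma).**  `𝒢` any adelic group datum, `N_i(𝔸) = 𝔓.radical i` a radical (locally compact), `ν_N` a regular Haar measure on it,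
`N_i(K) = 𝔓.rational i` countable with ONE fundamental domain `𝓕` of finite measure, `γ ∈ G(K)` (★ `arithmeticSubgroup`) with `γ N_i(𝔸) γ⁻¹ ⊆ N_i(𝔸)` and
`γ⁻¹ N_i(𝔸) γ ⊆ N_i(𝔸)`.  THEN the conjugation `u ↦ γuγ⁻¹` PRESERVES `ν_N`: it is a topological automorphism of `N_i(𝔸)` mapping the lattice `N_i(K) = N_i(𝔸) ∩ G(K)`
onto itself (`G(K)` is a subgroup), and an automorphism preserving a lattice of finite positive covolume has module `1` (★ `map_continuousMulEquiv_eq_self`).  This is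
`|δ_P(γ)|_𝔸 = 1` for `γ ∈ P(K)` — the hypothesis `hmod` of ★ `setIntegral_constantTerm_mul_eq_of_normalizes`. [cite: MoeglinWaldspurger1995, I.2.6] [cite: Raghunathan1972, Ch. I Remark 1.9] -/
theorem measurePreserving_conj_of_isFundamentalDomain [LocallyCompactSpace (𝔓.radical i)] (νN : Measure (𝔓.radical i)) [νN.IsHaarMeasure] [νN.Regular]
    [Countable (𝔓.rational i)] {γ : 𝒢.Adelic} (hγ : γ ∈ 𝒢.arithmeticSubgroup)
    (hN : ∀ u : 𝔓.radical i, γ * (u : 𝒢.Adelic) * γ⁻¹ ∈ 𝔓.radical i) (hN' : ∀ u : 𝔓.radical i, γ⁻¹ * (u : 𝒢.Adelic) * γ ∈ 𝔓.radical i)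
    {𝓕 : Set (𝔓.radical i)} (h𝓕 : IsFundamentalDomain (𝔓.rational i) 𝓕 νN) (htop : νN 𝓕 ≠ ∞) :
    MeasurePreserving (fun u : 𝔓.radical i => (⟨γ * (u : 𝒢.Adelic) * γ⁻¹, hN u⟩ : 𝔓.radical i)) νN νN := by
  -- conjugation by `γ` as a topological automorphism of `N_i(𝔸)`
  let φ : (𝔓.radical i) ≃ₜ* (𝔓.radical i) :=
    { toFun := fun u => ⟨γ * (u : 𝒢.Adelic) * γ⁻¹, hN u⟩
      invFun := fun w => ⟨γ⁻¹ * (w : 𝒢.Adelic) * γ, hN' w⟩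
      left_inv := fun u => Subtype.ext (by change γ⁻¹ * (γ * (u : 𝒢.Adelic) * γ⁻¹) * γ = u; group)
      right_inv := fun w => Subtype.ext (by change γ * (γ⁻¹ * (w : 𝒢.Adelic) * γ) * γ⁻¹ = w; group)
      map_mul' := fun u v => Subtype.ext (by
        change γ * ((u : 𝒢.Adelic) * v) * γ⁻¹ = γ * u * γ⁻¹ * (γ * v * γ⁻¹)
        group)
      continuous_toFun := ((continuous_const.mul continuous_subtype_val).mul continuous_const).subtype_mk _
      continuous_invFun := ((continuous_const.mul continuous_subtype_val).mul continuous_const).subtype_mk _ }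
  -- it maps the lattice `N_i(K)` onto itself
  have hΓ : ∀ g : 𝔓.radical i, φ g ∈ 𝔓.rational i ↔ g ∈ 𝔓.rational i := by
    intro g
    change γ * (g : 𝒢.Adelic) * γ⁻¹ ∈ 𝒢.arithmeticSubgroup ↔ (g : 𝒢.Adelic) ∈ 𝒢.arithmeticSubgroup
    refine ⟨fun h => ?_, fun h => Subgroup.mul_mem _ (Subgroup.mul_mem _ hγ h) (Subgroup.inv_mem _ hγ)⟩
    have h' := Subgroup.mul_mem _ (Subgroup.mul_mem _ (Subgroup.inv_mem _ hγ) h) hγ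
    rwa [show γ⁻¹ * (γ * (g : 𝒢.Adelic) * γ⁻¹) * γ = g by group] at h'
  have h0 : νN 𝓕 ≠ 0 := measure_fundamentalDomain_ne_zero 𝔓 νN h𝓕
  exact ⟨φ.continuous.measurable, map_continuousMulEquiv_eq_self νN (𝔓.rational i) h𝓕 h0 htop φ hΓ⟩

/-- **COROLLARY (★ p02's conjugation law with `hmod` DISCHARGED).**  Under the hypotheses of `measurePreserving_conj_of_isFundamentalDomain`, for every `ψ` on `G(𝔸) ⧸ Q`
and every `x ∈ G(𝔸)`: `∫_𝓕 ψ((xγu⁻¹)Q) dν_N(u) = ∫_𝓕 ψ((xu⁻¹)Q) dν_N(u)`, i.e. `CT_𝓕 ψ (x·γ) = CT_𝓕 ψ (x)` — the constant term along `N_i` is invariant under every rational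
normaliser of the radical (★ `setIntegral_constantTerm_mul_eq_of_normalizes`). [cite: MoeglinWaldspurger1995, I.2.6] [cite: BorelJacquet1979, §4.4] -/
theorem setIntegral_constantTerm_mul_eq_of_isFundamentalDomain [LocallyCompactSpace (𝔓.radical i)] (ψ : 𝒢.automorphicQuotient → ℂ)
    (νN : Measure (𝔓.radical i)) [νN.IsHaarMeasure] [νN.Regular] [Countable (𝔓.rational i)] {γ : 𝒢.Adelic} (hγ : γ ∈ 𝒢.arithmeticSubgroup)
    (hN : ∀ u : 𝔓.radical i, γ * (u : 𝒢.Adelic) * γ⁻¹ ∈ 𝔓.radical i) (hN' : ∀ u : 𝔓.radical i, γ⁻¹ * (u : 𝒢.Adelic) * γ ∈ 𝔓.radical i)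
    {𝓕 : Set (𝔓.radical i)} (h𝓕 : IsFundamentalDomain (𝔓.rational i) 𝓕 νN) (htop : νN 𝓕 ≠ ∞) (x : 𝒢.Adelic) :
    ∫ u in 𝓕, ψ (𝒢.toAutomorphicQuotient (x * γ * (u : 𝒢.Adelic)⁻¹)) ∂νN = ∫ u in 𝓕, ψ (𝒢.toAutomorphicQuotient (x * (u : 𝒢.Adelic)⁻¹)) ∂νN :=
  setIntegral_constantTerm_mul_eq_of_normalizes 𝔓 ψ νN hγ hN hN' (measurePreserving_conj_of_isFundamentalDomain 𝔓 νN hγ hN hN' h𝓕 htop) h𝓕 x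

end Generic

/-! ## §2 `U(Φ₂)`: the Siegel (= Borel) radical, `𝔓 := cmParabolicData L 2` -/

section Two

variable (L : Type) [Field L] [NumberField L] [IsCMField L]

/-- **The Siegel radical of `U(Φ₂)` is CLOSED in `U(Φ₂)(𝔸_{L⁺})`** (it is `val⁻¹` of the upper unitriangular group of `GL₂(𝔸_L)`, ★ `upperUnitriangular_eq_standardUnipotentRadical_two`,
★ `isClosed_upperUnitriangular`); hence locally compact, second countable, σ-compact. [cite: BorelJacquet1979, §4.4] -/
theorem isClosed_cmParabolicData_radical_two (i : (cmParabolicData L 2).ι) :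
    IsClosed (((cmParabolicData L 2).radical i : Set
      (cmDatum L 2 (Matrix.of fun i j : Fin 2 => if i.val + j.val + 1 = 2 then (1 : L) else 0)).Adelic)) := by
  obtain ⟨k, hk⟩ := i
  obtain rfl : k = 1 := by omega
  haveI := t2Space_adeleRing_of_numberField L
  have e : (((cmParabolicData L 2).radical ⟨1, hk⟩ : Set
      (cmDatum L 2 (Matrix.of fun i j : Fin 2 => if i.val + j.val + 1 = 2 then (1 : L) else 0)).Adelic)) =
      (adelicVal (↥(maximalRealSubfield L)) L (IsCMField.complexConj L) 2 (Matrix.of fun i j : Fin 2 => if i.val + j.val + 1 = 2 then (1 : L) else 0)) ⁻¹'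
        (upperUnitriangular (Fin 2) (AdeleRing (𝓞 L) L) : Set (GL (Fin 2) (AdeleRing (𝓞 L) L))) := by
    rw [upperUnitriangular_eq_standardUnipotentRadical_two]
    rfl
  rw [e]
  exact isClosed_upperUnitriangular.preimage continuous_subtype_val

/-- **Upper-triangular adelic points of `U(Φ₂)` normalise the Siegel radical**: for `γ ∈ U(Φ₂)(𝔸_{L⁺})` upper triangular in `GL₂(𝔸_L)` (the Borel `B(𝔸)`) and `u ∈ N(𝔸)`,
`γuγ⁻¹ ∈ N(𝔸)` (★ `standardParabolicGL_le_normalizer_unipotentRadicalGL`: `P_id` normalises `U_id` in `GL₂`). [cite: Rogawski1990, §1.10 p. 9] [cite: BorelJacquet1979, §4.4] -/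
theorem conj_mem_cmParabolicData_radical_two (i : (cmParabolicData L 2).ι)
    {γ : (cmDatum L 2 (Matrix.of fun i j : Fin 2 => if i.val + j.val + 1 = 2 then (1 : L) else 0)).Adelic}
    (hB : adelicVal (↥(maximalRealSubfield L)) L (IsCMField.complexConj L) 2 (Matrix.of fun i j : Fin 2 => if i.val + j.val + 1 = 2 then (1 : L) else 0) γ ∈
      standardParabolicGL (AdeleRing (𝓞 L) L) (id : Fin 2 → Fin 2))
    (u : (cmParabolicData L 2).radical i) :
    γ * (u : (cmDatum L 2 (Matrix.of fun i j : Fin 2 => if i.val + j.val + 1 = 2 then (1 : L) else 0)).Adelic) * γ⁻¹ ∈ (cmParabolicData L 2).radical i := by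
  obtain ⟨k, hk⟩ := i
  obtain rfl : k = 1 := by omega
  have hu : adelicVal (↥(maximalRealSubfield L)) L (IsCMField.complexConj L) 2 (Matrix.of fun i j : Fin 2 => if i.val + j.val + 1 = 2 then (1 : L) else 0)
      (u : (cmDatum L 2 (Matrix.of fun i j : Fin 2 => if i.val + j.val + 1 = 2 then (1 : L) else 0)).Adelic) ∈
      standardUnipotentRadical 2 1 (AdeleRing (𝓞 L) L) := u.2
  change adelicVal (↥(maximalRealSubfield L)) L (IsCMField.complexConj L) 2 (Matrix.of fun i j : Fin 2 => if i.val + j.val + 1 = 2 then (1 : L) else 0)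
      (γ * (u : (cmDatum L 2 (Matrix.of fun i j : Fin 2 => if i.val + j.val + 1 = 2 then (1 : L) else 0)).Adelic) * γ⁻¹) ∈
      standardUnipotentRadical 2 1 (AdeleRing (𝓞 L) L)
  rw [← upperUnitriangular_eq_standardUnipotentRadical_two] at hu ⊢
  change adelicVal (↥(maximalRealSubfield L)) L (IsCMField.complexConj L) 2 (Matrix.of fun i j : Fin 2 => if i.val + j.val + 1 = 2 then (1 : L) else 0) γ *
      adelicVal (↥(maximalRealSubfield L)) L (IsCMField.complexConj L) 2 (Matrix.of fun i j : Fin 2 => if i.val + j.val + 1 = 2 then (1 : L) else 0)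
        (u : (cmDatum L 2 (Matrix.of fun i j : Fin 2 => if i.val + j.val + 1 = 2 then (1 : L) else 0)).Adelic) *
      (adelicVal (↥(maximalRealSubfield L)) L (IsCMField.complexConj L) 2 (Matrix.of fun i j : Fin 2 => if i.val + j.val + 1 = 2 then (1 : L) else 0) γ)⁻¹ ∈
      upperUnitriangular (Fin 2) (AdeleRing (𝓞 L) L)
  have hle : standardParabolicGL (AdeleRing (𝓞 L) L) (id : Fin 2 → Fin 2) ≤
      Subgroup.normalizer (upperUnitriangular (Fin 2) (AdeleRing (𝓞 L) L) : Set (GL (Fin 2) (AdeleRing (𝓞 L) L))) :=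
    standardParabolicGL_le_normalizer_unipotentRadicalGL 2 (id : Fin 2 → Fin 2) (AdeleRing (𝓞 L) L)
  exact ((Subgroup.mem_normalizer_iff.1 (hle hB)) _).1 hu

/-- The inverse direction: `γ⁻¹uγ ∈ N(𝔸)` (`γ⁻¹` is again upper triangular). [cite: Rogawski1990, §1.10 p. 9] -/
theorem inv_conj_mem_cmParabolicData_radical_two (i : (cmParabolicData L 2).ι)
    {γ : (cmDatum L 2 (Matrix.of fun i j : Fin 2 => if i.val + j.val + 1 = 2 then (1 : L) else 0)).Adelic}
    (hB : adelicVal (↥(maximalRealSubfield L)) L (IsCMField.complexConj L) 2 (Matrix.of fun i j : Fin 2 => if i.val + j.val + 1 = 2 then (1 : L) else 0) γ ∈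
      standardParabolicGL (AdeleRing (𝓞 L) L) (id : Fin 2 → Fin 2))
    (u : (cmParabolicData L 2).radical i) :
    γ⁻¹ * (u : (cmDatum L 2 (Matrix.of fun i j : Fin 2 => if i.val + j.val + 1 = 2 then (1 : L) else 0)).Adelic) * γ ∈ (cmParabolicData L 2).radical i := by
  have h := conj_mem_cmParabolicData_radical_two L i (γ := γ⁻¹)
    (by
      change (adelicVal (↥(maximalRealSubfield L)) L (IsCMField.complexConj L) 2
        (Matrix.of fun i j : Fin 2 => if i.val + j.val + 1 = 2 then (1 : L) else 0) γ)⁻¹ ∈ _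
      exact Subgroup.inv_mem _ hB) u
  rwa [inv_inv] at h

/-- **MODULUS ONE ON `B(L⁺)` FOR `U(Φ₂)`.**  For every Haar measure `ν_N` on the Siegel radical `N(𝔸_{L⁺})` of `U(Φ₂)`, every fundamental domain `𝓕` of `N(L⁺)`, and every
RATIONAL UPPER-TRIANGULAR `γ` (`γ ∈ U(Φ₂)(L⁺)` diagonally embedded, `γ ∈ B`): the conjugation `u ↦ γuγ⁻¹` preserves `ν_N` — §1 with the lattice data ★
`countable_rational_cmParabolicData`, ★ `finiteCovolume_cmParabolicData_two` (Tate).  In particular `δ_B(m) = |a ā|_{𝔸_{L⁺}} = 1` for the rational Levi elements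
`m = diag(a, ā⁻¹)`, `a ∈ Lˣ`. [cite: MoeglinWaldspurger1995, I.2.6] [cite: Rogawski1990, §2.2 p. 13] [cite: Raghunathan1972, Ch. I Remark 1.9] -/
theorem measurePreserving_conj_cmParabolicData_two (i : (cmParabolicData L 2).ι)
    [MeasurableSpace ((cmParabolicData L 2).radical i)] [BorelSpace ((cmParabolicData L 2).radical i)]
    (νN : Measure ((cmParabolicData L 2).radical i)) [νN.IsHaarMeasure]
    {γ : (cmDatum L 2 (Matrix.of fun i j : Fin 2 => if i.val + j.val + 1 = 2 then (1 : L) else 0)).Adelic}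
    (hγ : γ ∈ (cmDatum L 2 (Matrix.of fun i j : Fin 2 => if i.val + j.val + 1 = 2 then (1 : L) else 0)).arithmeticSubgroup)
    (hB : adelicVal (↥(maximalRealSubfield L)) L (IsCMField.complexConj L) 2 (Matrix.of fun i j : Fin 2 => if i.val + j.val + 1 = 2 then (1 : L) else 0) γ ∈
      standardParabolicGL (AdeleRing (𝓞 L) L) (id : Fin 2 → Fin 2))
    {𝓕 : Set ((cmParabolicData L 2).radical i)} (h𝓕 : IsFundamentalDomain ((cmParabolicData L 2).rational i) 𝓕 νN) :
    MeasurePreserving (fun u : (cmParabolicData L 2).radical i =>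
      (⟨γ * (u : (cmDatum L 2 (Matrix.of fun i j : Fin 2 => if i.val + j.val + 1 = 2 then (1 : L) else 0)).Adelic) * γ⁻¹,
        conj_mem_cmParabolicData_radical_two L i hB u⟩ : (cmParabolicData L 2).radical i)) νN νN := by
  haveI := countable_rational_cmParabolicData L i
  haveI : LocallyCompactSpace ((cmParabolicData L 2).radical i) := (isClosed_cmParabolicData_radical_two L i).locallyCompactSpace
  haveI : SecondCountableTopology ((cmParabolicData L 2).radical i) := TopologicalSpace.Subtype.secondCountableTopology _
  haveI := TopologicalSpace.metrizableSpace_of_t3_secondCountable ((cmParabolicData L 2).radical i)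
  haveI : νN.Regular := inferInstance
  exact measurePreserving_conj_of_isFundamentalDomain (cmParabolicData L 2) νN hγ (conj_mem_cmParabolicData_radical_two L i hB)
    (inv_conj_mem_cmParabolicData_radical_two L i hB) h𝓕 (finiteCovolume_cmParabolicData_two L i νN 𝓕 h𝓕).ne

/-- **LEFT-`B(L⁺)`-INVARIANCE OF THE CONSTANT TERM FOR `U(Φ₂)`**: `CT_𝓕 ψ (x·γ) = CT_𝓕 ψ (x)` for every rational upper-triangular `γ`, every Haar `ν_N`, every fundamental domain `𝓕`
and every `ψ` on `U(Φ₂)(L⁺)∖U(Φ₂)(𝔸_{L⁺})` — ★ `setIntegral_constantTerm_mul_eq_of_normalizes` with all three binders supplied. [cite: MoeglinWaldspurger1995, I.2.6] [cite: BorelJacquet1979, §4.4] -/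
theorem setIntegral_constantTerm_mul_eq_cmParabolicData_two (i : (cmParabolicData L 2).ι)
    [MeasurableSpace ((cmParabolicData L 2).radical i)] [BorelSpace ((cmParabolicData L 2).radical i)]
    (ψ : (cmDatum L 2 (Matrix.of fun i j : Fin 2 => if i.val + j.val + 1 = 2 then (1 : L) else 0)).automorphicQuotient → ℂ)
    (νN : Measure ((cmParabolicData L 2).radical i)) [νN.IsHaarMeasure]
    {γ : (cmDatum L 2 (Matrix.of fun i j : Fin 2 => if i.val + j.val + 1 = 2 then (1 : L) else 0)).Adelic}
    (hγ : γ ∈ (cmDatum L 2 (Matrix.of fun i j : Fin 2 => if i.val + j.val + 1 = 2 then (1 : L) else 0)).arithmeticSubgroup)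
    (hB : adelicVal (↥(maximalRealSubfield L)) L (IsCMField.complexConj L) 2 (Matrix.of fun i j : Fin 2 => if i.val + j.val + 1 = 2 then (1 : L) else 0) γ ∈
      standardParabolicGL (AdeleRing (𝓞 L) L) (id : Fin 2 → Fin 2))
    {𝓕 : Set ((cmParabolicData L 2).radical i)} (h𝓕 : IsFundamentalDomain ((cmParabolicData L 2).rational i) 𝓕 νN)
    (x : (cmDatum L 2 (Matrix.of fun i j : Fin 2 => if i.val + j.val + 1 = 2 then (1 : L) else 0)).Adelic) :
    ∫ u in 𝓕, ψ ((cmDatum L 2 (Matrix.of fun i j : Fin 2 => if i.val + j.val + 1 = 2 then (1 : L) else 0)).toAutomorphicQuotient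
        (x * γ * (u : (cmDatum L 2 (Matrix.of fun i j : Fin 2 => if i.val + j.val + 1 = 2 then (1 : L) else 0)).Adelic)⁻¹)) ∂νN =
      ∫ u in 𝓕, ψ ((cmDatum L 2 (Matrix.of fun i j : Fin 2 => if i.val + j.val + 1 = 2 then (1 : L) else 0)).toAutomorphicQuotient
        (x * (u : (cmDatum L 2 (Matrix.of fun i j : Fin 2 => if i.val + j.val + 1 = 2 then (1 : L) else 0)).Adelic)⁻¹)) ∂νN := by
  haveI := countable_rational_cmParabolicData L i
  exact setIntegral_constantTerm_mul_eq_of_normalizes (cmParabolicData L 2) ψ νN hγ (conj_mem_cmParabolicData_radical_two L i hB)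
    (inv_conj_mem_cmParabolicData_radical_two L i hB) (measurePreserving_conj_cmParabolicData_two L i νN hγ hB h𝓕) h𝓕 x

end Two

/-! ## §3 `U(Φ₃)`: the Heisenberg radical of record, `𝔓 := cmParabolicDataR L 3` -/

section Three

variable (L : Type) [Field L] [NumberField L] [IsCMField L]

/-- **The Heisenberg radical of `U(Φ₃)` is CLOSED in `U(Φ₃)(𝔸_{L⁺})`** (`val⁻¹` of the upper unitriangular group of `GL₃(𝔸_L)`, ★ `upperUnitriangular_eq_flagUnipotentRadical_three`,
★ `isClosed_upperUnitriangular`). [cite: BorelJacquet1979, §4.4] -/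
theorem isClosed_cmParabolicDataR_radical_three (i : (cmParabolicDataR L 3).ι) :
    IsClosed (((cmParabolicDataR L 3).radical i : Set
      (cmDatum L 3 (Matrix.of fun i j : Fin 3 => if i.val + j.val + 1 = 3 then (1 : L) else 0)).Adelic)) := by
  obtain ⟨k, hk⟩ := i
  obtain rfl : k = 1 := by omega
  haveI := t2Space_adeleRing_of_numberField L
  have e : (((cmParabolicDataR L 3).radical ⟨1, hk⟩ : Set
      (cmDatum L 3 (Matrix.of fun i j : Fin 3 => if i.val + j.val + 1 = 3 then (1 : L) else 0)).Adelic)) =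
      (adelicVal (↥(maximalRealSubfield L)) L (IsCMField.complexConj L) 3 (Matrix.of fun i j : Fin 3 => if i.val + j.val + 1 = 3 then (1 : L) else 0)) ⁻¹'
        (upperUnitriangular (Fin 3) (AdeleRing (𝓞 L) L) : Set (GL (Fin 3) (AdeleRing (𝓞 L) L))) := by
    rw [upperUnitriangular_eq_flagUnipotentRadical_three]
    rfl
  rw [e]
  exact isClosed_upperUnitriangular.preimage continuous_subtype_val

/-- **Upper-triangular adelic points of `U(Φ₃)` normalise the Heisenberg radical**: `γ ∈ B(𝔸)`, `u ∈ N(𝔸)` ⟹ `γuγ⁻¹ ∈ N(𝔸)` (★ `P_id` normalises `U_id` in `GL₃`; in coordinates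
`m(a,b) u(x,z) m(a,b)⁻¹ = u(a x b⁻¹, (aā) z)`, ★ `heisX_conjBy` ∕ `coe_heisY_conjBy`). [cite: Rogawski1990, §1.10 p. 9] [cite: BorelJacquet1979, §4.4] -/
theorem conj_mem_cmParabolicDataR_radical_three (i : (cmParabolicDataR L 3).ι)
    {γ : (cmDatum L 3 (Matrix.of fun i j : Fin 3 => if i.val + j.val + 1 = 3 then (1 : L) else 0)).Adelic}
    (hB : adelicVal (↥(maximalRealSubfield L)) L (IsCMField.complexConj L) 3 (Matrix.of fun i j : Fin 3 => if i.val + j.val + 1 = 3 then (1 : L) else 0) γ ∈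
      standardParabolicGL (AdeleRing (𝓞 L) L) (id : Fin 3 → Fin 3))
    (u : (cmParabolicDataR L 3).radical i) :
    γ * (u : (cmDatum L 3 (Matrix.of fun i j : Fin 3 => if i.val + j.val + 1 = 3 then (1 : L) else 0)).Adelic) * γ⁻¹ ∈ (cmParabolicDataR L 3).radical i := by
  obtain ⟨k, hk⟩ := i
  obtain rfl : k = 1 := by omega
  have hu : adelicVal (↥(maximalRealSubfield L)) L (IsCMField.complexConj L) 3 (Matrix.of fun i j : Fin 3 => if i.val + j.val + 1 = 3 then (1 : L) else 0)
      (u : (cmDatum L 3 (Matrix.of fun i j : Fin 3 => if i.val + j.val + 1 = 3 then (1 : L) else 0)).Adelic) ∈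
      flagUnipotentRadical 3 1 (AdeleRing (𝓞 L) L) := u.2
  change adelicVal (↥(maximalRealSubfield L)) L (IsCMField.complexConj L) 3 (Matrix.of fun i j : Fin 3 => if i.val + j.val + 1 = 3 then (1 : L) else 0)
      (γ * (u : (cmDatum L 3 (Matrix.of fun i j : Fin 3 => if i.val + j.val + 1 = 3 then (1 : L) else 0)).Adelic) * γ⁻¹) ∈
      flagUnipotentRadical 3 1 (AdeleRing (𝓞 L) L)
  rw [← upperUnitriangular_eq_flagUnipotentRadical_three] at hu ⊢
  change adelicVal (↥(maximalRealSubfield L)) L (IsCMField.complexConj L) 3 (Matrix.of fun i j : Fin 3 => if i.val + j.val + 1 = 3 then (1 : L) else 0) γ *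
      adelicVal (↥(maximalRealSubfield L)) L (IsCMField.complexConj L) 3 (Matrix.of fun i j : Fin 3 => if i.val + j.val + 1 = 3 then (1 : L) else 0)
        (u : (cmDatum L 3 (Matrix.of fun i j : Fin 3 => if i.val + j.val + 1 = 3 then (1 : L) else 0)).Adelic) *
      (adelicVal (↥(maximalRealSubfield L)) L (IsCMField.complexConj L) 3 (Matrix.of fun i j : Fin 3 => if i.val + j.val + 1 = 3 then (1 : L) else 0) γ)⁻¹ ∈
      upperUnitriangular (Fin 3) (AdeleRing (𝓞 L) L)
  have hle : standardParabolicGL (AdeleRing (𝓞 L) L) (id : Fin 3 → Fin 3) ≤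
      Subgroup.normalizer (upperUnitriangular (Fin 3) (AdeleRing (𝓞 L) L) : Set (GL (Fin 3) (AdeleRing (𝓞 L) L))) :=
    standardParabolicGL_le_normalizer_unipotentRadicalGL 3 (id : Fin 3 → Fin 3) (AdeleRing (𝓞 L) L)
  exact ((Subgroup.mem_normalizer_iff.1 (hle hB)) _).1 hu

/-- The inverse direction for `U(Φ₃)`: `γ⁻¹uγ ∈ N(𝔸)`. [cite: Rogawski1990, §1.10 p. 9] -/
theorem inv_conj_mem_cmParabolicDataR_radical_three (i : (cmParabolicDataR L 3).ι)
    {γ : (cmDatum L 3 (Matrix.of fun i j : Fin 3 => if i.val + j.val + 1 = 3 then (1 : L) else 0)).Adelic}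
    (hB : adelicVal (↥(maximalRealSubfield L)) L (IsCMField.complexConj L) 3 (Matrix.of fun i j : Fin 3 => if i.val + j.val + 1 = 3 then (1 : L) else 0) γ ∈
      standardParabolicGL (AdeleRing (𝓞 L) L) (id : Fin 3 → Fin 3))
    (u : (cmParabolicDataR L 3).radical i) :
    γ⁻¹ * (u : (cmDatum L 3 (Matrix.of fun i j : Fin 3 => if i.val + j.val + 1 = 3 then (1 : L) else 0)).Adelic) * γ ∈ (cmParabolicDataR L 3).radical i := by
  have h := conj_mem_cmParabolicDataR_radical_three L i (γ := γ⁻¹)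
    (by
      change (adelicVal (↥(maximalRealSubfield L)) L (IsCMField.complexConj L) 3
        (Matrix.of fun i j : Fin 3 => if i.val + j.val + 1 = 3 then (1 : L) else 0) γ)⁻¹ ∈ _
      exact Subgroup.inv_mem _ hB) u
  rwa [inv_inv] at h

/-- **MODULUS ONE ON `B(L⁺)` FOR `U(Φ₃)`.**  For every Haar measure `ν_N` on the Heisenberg radical `N(𝔸_{L⁺})` of `U(Φ₃)`, every fundamental domain `𝓕` of `N(L⁺)` and every
RATIONAL UPPER-TRIANGULAR `γ`: `u ↦ γuγ⁻¹` preserves `ν_N` (§1 + ★ `countable_rational_cmParabolicDataR_three`, ★ `finiteCovolume_cmParabolicDataR_three`).  In particular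
`δ_B(m) = |a ā|²_{𝔸_{L⁺}}·|…| = ‖a‖²_{𝔸_L} = 1` for the rational Levi elements `m = diag(a, b, ā⁻¹)` (`a ∈ Lˣ`, `b b̄ = 1`; ★ `modularCharacter_borelAdelic_torus` for the adelic
value). [cite: MoeglinWaldspurger1995, I.2.6] [cite: Rogawski1990, §2.2 p. 13] [cite: Raghunathan1972, Ch. I Remark 1.9] -/
theorem measurePreserving_conj_cmParabolicDataR_three (i : (cmParabolicDataR L 3).ι)
    [MeasurableSpace ((cmParabolicDataR L 3).radical i)] [BorelSpace ((cmParabolicDataR L 3).radical i)]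
    (νN : Measure ((cmParabolicDataR L 3).radical i)) [νN.IsHaarMeasure]
    {γ : (cmDatum L 3 (Matrix.of fun i j : Fin 3 => if i.val + j.val + 1 = 3 then (1 : L) else 0)).Adelic}
    (hγ : γ ∈ (cmDatum L 3 (Matrix.of fun i j : Fin 3 => if i.val + j.val + 1 = 3 then (1 : L) else 0)).arithmeticSubgroup)
    (hB : adelicVal (↥(maximalRealSubfield L)) L (IsCMField.complexConj L) 3 (Matrix.of fun i j : Fin 3 => if i.val + j.val + 1 = 3 then (1 : L) else 0) γ ∈
      standardParabolicGL (AdeleRing (𝓞 L) L) (id : Fin 3 → Fin 3))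
    {𝓕 : Set ((cmParabolicDataR L 3).radical i)} (h𝓕 : IsFundamentalDomain ((cmParabolicDataR L 3).rational i) 𝓕 νN) :
    MeasurePreserving (fun u : (cmParabolicDataR L 3).radical i =>
      (⟨γ * (u : (cmDatum L 3 (Matrix.of fun i j : Fin 3 => if i.val + j.val + 1 = 3 then (1 : L) else 0)).Adelic) * γ⁻¹,
        conj_mem_cmParabolicDataR_radical_three L i hB u⟩ : (cmParabolicDataR L 3).radical i)) νN νN := by
  haveI := countable_rational_cmParabolicDataR_three L i
  haveI : LocallyCompactSpace ((cmParabolicDataR L 3).radical i) := (isClosed_cmParabolicDataR_radical_three L i).locallyCompactSpace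
  haveI : SecondCountableTopology ((cmParabolicDataR L 3).radical i) := TopologicalSpace.Subtype.secondCountableTopology _
  haveI := TopologicalSpace.metrizableSpace_of_t3_secondCountable ((cmParabolicDataR L 3).radical i)
  haveI : νN.Regular := inferInstance
  exact measurePreserving_conj_of_isFundamentalDomain (cmParabolicDataR L 3) νN hγ (conj_mem_cmParabolicDataR_radical_three L i hB)
    (inv_conj_mem_cmParabolicDataR_radical_three L i hB) h𝓕 (finiteCovolume_cmParabolicDataR_three L i νN 𝓕 h𝓕).ne

/-- **LEFT-`B(L⁺)`-INVARIANCE OF THE CONSTANT TERM FOR `U(Φ₃)`** (Heisenberg radical of record): `CT_𝓕 ψ (x·γ) = CT_𝓕 ψ (x)` for every rational upper-triangular `γ`, every Haar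
`ν_N`, every fundamental domain `𝓕`, every `ψ`. [cite: MoeglinWaldspurger1995, I.2.6] [cite: BorelJacquet1979, §4.4] -/
theorem setIntegral_constantTerm_mul_eq_cmParabolicDataR_three (i : (cmParabolicDataR L 3).ι)
    [MeasurableSpace ((cmParabolicDataR L 3).radical i)] [BorelSpace ((cmParabolicDataR L 3).radical i)]
    (ψ : (cmDatum L 3 (Matrix.of fun i j : Fin 3 => if i.val + j.val + 1 = 3 then (1 : L) else 0)).automorphicQuotient → ℂ)
    (νN : Measure ((cmParabolicDataR L 3).radical i)) [νN.IsHaarMeasure]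
    {γ : (cmDatum L 3 (Matrix.of fun i j : Fin 3 => if i.val + j.val + 1 = 3 then (1 : L) else 0)).Adelic}
    (hγ : γ ∈ (cmDatum L 3 (Matrix.of fun i j : Fin 3 => if i.val + j.val + 1 = 3 then (1 : L) else 0)).arithmeticSubgroup)
    (hB : adelicVal (↥(maximalRealSubfield L)) L (IsCMField.complexConj L) 3 (Matrix.of fun i j : Fin 3 => if i.val + j.val + 1 = 3 then (1 : L) else 0) γ ∈
      standardParabolicGL (AdeleRing (𝓞 L) L) (id : Fin 3 → Fin 3))
    {𝓕 : Set ((cmParabolicDataR L 3).radical i)} (h𝓕 : IsFundamentalDomain ((cmParabolicDataR L 3).rational i) 𝓕 νN)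
    (x : (cmDatum L 3 (Matrix.of fun i j : Fin 3 => if i.val + j.val + 1 = 3 then (1 : L) else 0)).Adelic) :
    ∫ u in 𝓕, ψ ((cmDatum L 3 (Matrix.of fun i j : Fin 3 => if i.val + j.val + 1 = 3 then (1 : L) else 0)).toAutomorphicQuotient
        (x * γ * (u : (cmDatum L 3 (Matrix.of fun i j : Fin 3 => if i.val + j.val + 1 = 3 then (1 : L) else 0)).Adelic)⁻¹)) ∂νN =
      ∫ u in 𝓕, ψ ((cmDatum L 3 (Matrix.of fun i j : Fin 3 => if i.val + j.val + 1 = 3 then (1 : L) else 0)).toAutomorphicQuotient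
        (x * (u : (cmDatum L 3 (Matrix.of fun i j : Fin 3 => if i.val + j.val + 1 = 3 then (1 : L) else 0)).Adelic)⁻¹)) ∂νN := by
  haveI := countable_rational_cmParabolicDataR_three L i
  exact setIntegral_constantTerm_mul_eq_of_normalizes (cmParabolicDataR L 3) ψ νN hγ (conj_mem_cmParabolicDataR_radical_three L i hB)
    (inv_conj_mem_cmParabolicDataR_radical_three L i hB) (measurePreserving_conj_cmParabolicDataR_three L i νN hγ hB h𝓕) h𝓕 x

end Three

/-! ## §4 Rational Borel points as inputs: `γ := toAdelic g`, `g ∈ U(Φ_N)(L⁺)` upper triangular (e.g. a rational Levi element) -/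

section RationalBorel

variable (L : Type) [Field L] [NumberField L] [IsCMField L] (N : ℕ)

/-- `toAdelic g` is rational (it IS the diagonal embedding). [folklore] -/
theorem toAdelic_mem_arithmeticSubgroup (H : Matrix (Fin N) (Fin N) L) (g : unitaryGroup (cmConjRingHom L) H) :
    (cmDatum L N H).toAdelic g ∈ (cmDatum L N H).arithmeticSubgroup :=
  ⟨g, rfl⟩

/-- **An upper-triangular rational point stays upper triangular in `GL_N(𝔸_L)`**: the adelic matrix of `toAdelic g` is the entrywise diagonal embedding of `g` (★ `coe_cmDatum_toAdelic`,
★ `val_toAdeleGL`), and `algebraMap L 𝔸_L` maps `0` to `0`.  With `toAdelic_mem_arithmeticSubgroup` these are the two binders `hγ`, `hB` of §2–§3; rational LEVI elements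
`diag(a, ā⁻¹) ∈ U(Φ₂)(L⁺)`, `diag(a, b, ā⁻¹) ∈ U(Φ₃)(L⁺)` (★ `glDiagonal_mem_unitaryGroupOfForm_antidiagonal_iff`) are the diagonal case. [cite: Rogawski1990, §1.10 p. 9] -/
theorem adelicVal_toAdelic_mem_standardParabolicGL (H : Matrix (Fin N) (Fin N) L) (g : unitaryGroup (cmConjRingHom L) H)
    (hg : ((g : GL (Fin N) L) : Matrix (Fin N) (Fin N) L).BlockTriangular id) :
    adelicVal (↥(maximalRealSubfield L)) L (IsCMField.complexConj L) N H ((cmDatum L N H).toAdelic g) ∈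
      standardParabolicGL (AdeleRing (𝓞 L) L) (id : Fin N → Fin N) := by
  rw [mem_standardParabolicGL_iff]
  change ((((cmDatum L N H).toAdelic g).val : GL (Fin N) (AdeleRing (𝓞 L) L)) : Matrix (Fin N) (Fin N) (AdeleRing (𝓞 L) L)).BlockTriangular id
  rw [coe_cmDatum_toAdelic, val_toAdeleGL]
  intro i j hij
  rw [Matrix.map_apply, hg hij, map_zero]

end RationalBorel

end Summit.HodgeConjecture.HodgeConjecture.Cruxes.H413.K2E1BorelLeviU

end
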